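import Summits.QuantumFields.YangMills.Theorems.UnitScaleTiltProp7TransportedInterpolantGradient
import HarnessLib

/-!
# Route `UnitScaleTilt`, crux K1 «MinimiserStabilityRegPr» (stmt-QuantumFields-19200), EX face — K-storey (px12 g16 LOCATE-K137), pen (K1b-a) (px13 g15; LOCATE #43 §6 (F3b)) —
# **(K1b-a) AT THE MEMBER: ALL THREE ROWS (a), (s1), (s2) OF THE TRANSPORTED INTERPOLANT OF `Q_k(U₀)` ON `RegPr`, EXPLICIT CONSTANTS**

Cell `ym3-torus` (HUMAN RULING D-0037; rung R3 = SU(2) YM₃ on T³ — NOT d = 4, NOT infinite volume, NOT a mass gap, NOT Clay).  Width seat `ym3-torus-px13` (gen 15).  THEOREMS ONLY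
(0 `def`, 0 `sorry`); `--supports stmt-QuantumFields-19200 --as helper`; count-neutral; nothing of Bałaban's asserted.

WHAT IS PROVED (ns `…Theorems.Prop7TransportedInterpolantRowsOfRegPr`).
* ★★★ `exists_transportedInterpolant_rows_of_regPr` — `RegPr F n K ε₀ U₀`, `10¹⁰L⁶ε₀ ≤ 1`, `10¹²L³ε₀ ≤ 1`, `n < K`, no-wrap `2(3(ℓ−1) + 8ℓ + 1) ≤ (F.P K).sitesPerDir 0` ⟹ `∃ E : WL2 →ₗ[ℂ] BondL2K`,
  (a) `‖Q_k(U₀)(E c) − c‖ ≤ ½‖c‖` ∧ (s1) `‖E c‖ ≤ 45·√(c₀ℓ³∕cB)·‖c‖` (✓`Prop7TransportedInterpolantOfRegPr.exists_transportedInterpolant_of_regPr`) ∧ (s2)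
  `Σ_μ‖D^η_{U₀}(toL2S (toL2⁻¹(E c))^μ)‖² ≤ C_D·‖c‖²` with the EXPLICIT `C_D = 2c₀η⁻²·B_c²·d·ℓ^d∕cB` of ✓`Prop7TransportedInterpolantGradient.hED_of_formula` at the skew ⊗ parabola² letters
  (`M_p = ℓ₁²`, `L_p = P_l = ℓ₁`, `M_τ = ℓ²∕4`, `L_τ = ℓ`, `m = m̂⁻¹`; ✓`Prop7SkewBumpProfile`, ✓`Prop7CovariantBlockBumpsProfile`) — the three letters `hQE` (`θ = ½`), `hE₁`, `hED` of
  px12 ✓`Prop7KinvBoundOfInterpolant.norm_KinvT_le_of_interpolant_rows` at the member.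
HONEST SCOPE.  (K1b) = px12's knit, K137, EX and the crux are NOT proved here; the K-free majorant `C_D ≤ CDL·(c₀∕cB)ℓ³` is stated separately when typed.

References: T. Bałaban, CMP **99** (1985) 389–434 [Balaban1985BackgroundPropagators] ((3.13)–(3.16) p.393, (3.126)–(3.132) pp.420–422); CMP **95** (1984) 17–40 [Balaban1984PropagatorsI]
((1.18) p.20, (1.47)–(1.50) p.26); CMP **99** (1985) 75–102 [Balaban1985RegularSpaces] (Lemma 1 (1.25) p.79).
-/

set_option autoImplicit false

noncomputable section

open scoped BigOperators Matrix.Norms.L2Operator Matrix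

namespace Summit.QuantumFields.YangMills.Theorems.Prop7TransportedInterpolantRowsOfRegPr

open Literature.MathematicalPhysics.QuantumFieldTheory.Balaban1983to89
open Literature.MathematicalPhysics.QuantumFieldTheory.Balaban1983to89.T3ContinuumYM3Torus
open Finset T4Continuum BlockAveraging LatticeFieldCalculus B1RG242Torus
open B5Eq118OneStroke (iterBlockOf)
open B7Eq78Linearization (conjR)
open B9Eq311L2Pairing (WL2)
open B10Eq27TorusAxialLog (axialT unitsField toUField suIncl)
open B11Eq103H1Complex (BondL2K)
open B15DeterminingSets (embIter)
open T3LevelShift (bondShift)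
open T3PrintedRegularOrbits (sites_eq)
open T3PrintedRegularMinimiser (RegPr)
open T3RegularMinimiser (regThreshold regThreshold_pos)
open T3SectALandauChart (eta eta_pos bgUnits formComp)
open Summit.QuantumFields.YangMills.Theorems.Prop7SectET3Transport (periodsT3)
open Summit.QuantumFields.YangMills.Theorems.Prop7SectET3HilbertLetters (W₂ toL2 toL2B toL2S DL2)
open Summit.QuantumFields.YangMills.Theorems.Prop7SectET3CurvedPropagators (Qk)
open Summit.QuantumFields.YangMills.Theorems.Prop7TransportedInterpolantGradient (hED_of_formula)

/-! ## The K-free arithmetic of `C_D` (pure real algebra) -/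

section Real

/-- The real-variable core of ★★`CD_le_kfree`: with `3 ≤ ℓ`, `4q ≤ ℓ < 4(q+1)`, `OWN ≥ (ℓ−q)(q+1)(q+2)(q+3)∕6`, `T ≥ ℓ³∕27`, `a₀ℓ² = ε₀ ≤ ⅓`,
`2c₀·ℓ²·(B_c²·3·ℓ³)·cB⁻¹ ≤ 33·10⁸·(c₀∕cB)ℓ³`. [folklore] -/
theorem kfree_real (c₀ cB ℓF OWN T a₀ ε₀ : ℝ) (q : ℕ) (hc₀ : 0 < c₀) (hcB : 0 < cB) (hℓF3 : 3 ≤ ℓF) (hqr : 4 * (q : ℝ) ≤ ℓF)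
    (hqr' : ℓF < 4 * ((q : ℝ) + 1))
    (hOWNge : (ℓF - q) * (((q : ℝ) + 1) * ((q : ℝ) + 1 + 1) * ((q : ℝ) + 1 + 2) / 6) ≤ OWN) (hmass : ℓF ^ 3 / 27 ≤ T)
    (ha₀pos : 0 < a₀) (ha₀' : a₀ * ℓF ^ 2 = ε₀) (hε3 : ε₀ ≤ 1 / 3) :
    2 * c₀ * (ℓF ^ 2 * ((|(OWN * T ^ 2 * (ℓF ^ 4)⁻¹)⁻¹| *
        (2 * (((q : ℝ) + 1) ^ 2 * (ℓF ^ 2 / 4) ^ 2) * (2 * (3 * (ℓF - 1)) * a₀)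
          + (((q : ℝ) + 1) * (ℓF ^ 2 / 4) ^ 2 + ((q : ℝ) + 1) ^ 2 * ℓF * (ℓF ^ 2 / 4)) + ((q : ℝ) + 1) * (ℓF ^ 2 / 4) ^ 2)) ^ 2 * 3 * ℓF ^ 3)) * cB⁻¹
      ≤ 33 * 10 ^ 8 * ((c₀ / cB) * ℓF ^ 3) := by
  have hq0 : (0 : ℝ) ≤ q := Nat.cast_nonneg _
  have hlq0 : (0 : ℝ) ≤ ℓF - q := by linarith
  -- positivity of the atoms
  have hTge : ℓF ^ 3 / 27 ≤ T := hmass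
  have hTpos : 0 < T := lt_of_lt_of_le (by positivity) hTge
  have hOWNge' : ℓF * ((q : ℝ) + 1) ^ 3 / 8 ≤ OWN := by
    refine le_trans ?_ hOWNge
    have h34 : (3 : ℝ) / 4 * ℓF ≤ ℓF - q := by linarith
    have hA : ((q : ℝ) + 1) ^ 3 ≤ ((q : ℝ) + 1) * ((q : ℝ) + 1 + 1) * ((q : ℝ) + 1 + 2) := by nlinarith [sq_nonneg ((q : ℝ) + 1)]
    calc ℓF * ((q : ℝ) + 1) ^ 3 / 8 = ((3 : ℝ) / 4 * ℓF) * (((q : ℝ) + 1) ^ 3 / 6) := by ring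
      _ ≤ (ℓF - q) * (((q : ℝ) + 1) * ((q : ℝ) + 1 + 1) * ((q : ℝ) + 1 + 2) / 6) := by gcongr
  have hOWNpos : 0 < OWN := lt_of_lt_of_le (by positivity) hOWNge'
  have hmpos : 0 < OWN * T ^ 2 * (ℓF ^ 4)⁻¹ := by positivity
  rw [abs_of_pos (inv_pos.mpr hmpos)]
  -- the bracket `≤ 4ℓ²ℓ₁³`
  have hℓ₁ : ℓF ≤ 4 * ((q : ℝ) + 1) := hqr'.le
  have hq1 : (1 : ℝ) ≤ (q : ℝ) + 1 := by linarith
  have hs : 2 * (3 * (ℓF - 1)) * a₀ ≤ 6 * ε₀ / ℓF := by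
    rw [le_div_iff₀ (by positivity)]
    nlinarith [ha₀pos, ha₀']
  have hbr : 2 * (((q : ℝ) + 1) ^ 2 * (ℓF ^ 2 / 4) ^ 2) * (2 * (3 * (ℓF - 1)) * a₀)
        + (((q : ℝ) + 1) * (ℓF ^ 2 / 4) ^ 2 + ((q : ℝ) + 1) ^ 2 * ℓF * (ℓF ^ 2 / 4)) + ((q : ℝ) + 1) * (ℓF ^ 2 / 4) ^ 2
      ≤ 4 * (ℓF ^ 2 * ((q : ℝ) + 1) ^ 3) := by
    have hℓsq : ℓF ^ 2 ≤ 16 * ((q : ℝ) + 1) ^ 2 := by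
      have := pow_le_pow_left₀ (by linarith : (0 : ℝ) ≤ ℓF) hℓ₁ 2
      linarith [this, show (4 * ((q : ℝ) + 1)) ^ 2 = 16 * ((q : ℝ) + 1) ^ 2 by ring]
    have h1 : ((q : ℝ) + 1) * (ℓF ^ 2 / 4) ^ 2 ≤ ℓF ^ 2 * ((q : ℝ) + 1) ^ 3 := by
      calc ((q : ℝ) + 1) * (ℓF ^ 2 / 4) ^ 2 = (((q : ℝ) + 1) * ℓF ^ 2) * (ℓF ^ 2 / 16) := by ring
        _ ≤ (((q : ℝ) + 1) * ℓF ^ 2) * (((q : ℝ) + 1) ^ 2) := mul_le_mul_of_nonneg_left (by linarith) (by positivity)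
        _ = ℓF ^ 2 * ((q : ℝ) + 1) ^ 3 := by ring
    have h2 : ((q : ℝ) + 1) ^ 2 * ℓF * (ℓF ^ 2 / 4) ≤ ℓF ^ 2 * ((q : ℝ) + 1) ^ 3 := by
      calc ((q : ℝ) + 1) ^ 2 * ℓF * (ℓF ^ 2 / 4) = (((q : ℝ) + 1) ^ 2 * ℓF ^ 2) * (ℓF / 4) := by ring
        _ ≤ (((q : ℝ) + 1) ^ 2 * ℓF ^ 2) * ((q : ℝ) + 1) := mul_le_mul_of_nonneg_left (by linarith) (by positivity)
        _ = ℓF ^ 2 * ((q : ℝ) + 1) ^ 3 := by ring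
    have h3 : 2 * (((q : ℝ) + 1) ^ 2 * (ℓF ^ 2 / 4) ^ 2) * (2 * (3 * (ℓF - 1)) * a₀) ≤ ℓF ^ 2 * ((q : ℝ) + 1) ^ 3 := by
      have hx : 0 ≤ 2 * (((q : ℝ) + 1) ^ 2 * (ℓF ^ 2 / 4) ^ 2) := by positivity
      calc 2 * (((q : ℝ) + 1) ^ 2 * (ℓF ^ 2 / 4) ^ 2) * (2 * (3 * (ℓF - 1)) * a₀)
          ≤ 2 * (((q : ℝ) + 1) ^ 2 * (ℓF ^ 2 / 4) ^ 2) * (6 * ε₀ / ℓF) := mul_le_mul_of_nonneg_left hs hx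
        _ = (3 / 4) * ((q : ℝ) + 1) ^ 2 * ℓF ^ 3 * ε₀ := by field_simp; ring
        _ ≤ (3 / 4) * ((q : ℝ) + 1) ^ 2 * ℓF ^ 3 * (1 / 3) := by gcongr
        _ = (((q : ℝ) + 1) ^ 2 * ℓF ^ 2) * (ℓF / 4) := by ring
        _ ≤ (((q : ℝ) + 1) ^ 2 * ℓF ^ 2) * ((q : ℝ) + 1) := mul_le_mul_of_nonneg_left (by linarith) (by positivity)
        _ = ℓF ^ 2 * ((q : ℝ) + 1) ^ 3 := by ring
    linarith
  -- `B_c·ℓ ≤ 23328`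
  have hm : (OWN * T ^ 2 * (ℓF ^ 4)⁻¹)⁻¹ = ℓF ^ 4 / (OWN * T ^ 2) := by
    field_simp
  have hBc : (OWN * T ^ 2 * (ℓF ^ 4)⁻¹)⁻¹ * (2 * (((q : ℝ) + 1) ^ 2 * (ℓF ^ 2 / 4) ^ 2) * (2 * (3 * (ℓF - 1)) * a₀)
        + (((q : ℝ) + 1) * (ℓF ^ 2 / 4) ^ 2 + ((q : ℝ) + 1) ^ 2 * ℓF * (ℓF ^ 2 / 4)) + ((q : ℝ) + 1) * (ℓF ^ 2 / 4) ^ 2) * ℓF ≤ 23328 := by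
    rw [hm]
    have hbr0 : 0 ≤ 2 * (((q : ℝ) + 1) ^ 2 * (ℓF ^ 2 / 4) ^ 2) * (2 * (3 * (ℓF - 1)) * a₀)
        + (((q : ℝ) + 1) * (ℓF ^ 2 / 4) ^ 2 + ((q : ℝ) + 1) ^ 2 * ℓF * (ℓF ^ 2 / 4)) + ((q : ℝ) + 1) * (ℓF ^ 2 / 4) ^ 2 := by
      have : 0 ≤ ℓF - 1 := by linarith
      positivity
    have hden : 0 < OWN * T ^ 2 := by positivity
    rw [div_mul_eq_mul_div, div_mul_eq_mul_div, div_le_iff₀ hden]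
    have hOT : ℓF * ((q : ℝ) + 1) ^ 3 / 8 * (ℓF ^ 3 / 27) ^ 2 ≤ OWN * T ^ 2 :=
      mul_le_mul hOWNge' (pow_le_pow_left₀ (by positivity) hTge 2) (by positivity) hOWNpos.le
    calc ℓF ^ 4 * (2 * (((q : ℝ) + 1) ^ 2 * (ℓF ^ 2 / 4) ^ 2) * (2 * (3 * (ℓF - 1)) * a₀)
          + (((q : ℝ) + 1) * (ℓF ^ 2 / 4) ^ 2 + ((q : ℝ) + 1) ^ 2 * ℓF * (ℓF ^ 2 / 4)) + ((q : ℝ) + 1) * (ℓF ^ 2 / 4) ^ 2) * ℓF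
        ≤ ℓF ^ 4 * (4 * (ℓF ^ 2 * ((q : ℝ) + 1) ^ 3)) * ℓF := by gcongr
      _ = 23328 * (ℓF * ((q : ℝ) + 1) ^ 3 / 8 * (ℓF ^ 3 / 27) ^ 2) := by ring
      _ ≤ 23328 * (OWN * T ^ 2) := mul_le_mul_of_nonneg_left hOT (by norm_num)
  -- assemble
  have hB0 : 0 ≤ (OWN * T ^ 2 * (ℓF ^ 4)⁻¹)⁻¹ * (2 * (((q : ℝ) + 1) ^ 2 * (ℓF ^ 2 / 4) ^ 2) * (2 * (3 * (ℓF - 1)) * a₀)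
        + (((q : ℝ) + 1) * (ℓF ^ 2 / 4) ^ 2 + ((q : ℝ) + 1) ^ 2 * ℓF * (ℓF ^ 2 / 4)) + ((q : ℝ) + 1) * (ℓF ^ 2 / 4) ^ 2) := by
    have : 0 ≤ ℓF - 1 := by linarith
    positivity
  calc 2 * c₀ * (ℓF ^ 2 * (((OWN * T ^ 2 * (ℓF ^ 4)⁻¹)⁻¹ * (2 * (((q : ℝ) + 1) ^ 2 * (ℓF ^ 2 / 4) ^ 2) * (2 * (3 * (ℓF - 1)) * a₀)
        + (((q : ℝ) + 1) * (ℓF ^ 2 / 4) ^ 2 + ((q : ℝ) + 1) ^ 2 * ℓF * (ℓF ^ 2 / 4)) + ((q : ℝ) + 1) * (ℓF ^ 2 / 4) ^ 2)) ^ 2 * 3 * ℓF ^ 3)) * cB⁻¹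
      = 6 * (c₀ / cB) * ℓF ^ 3 * (((OWN * T ^ 2 * (ℓF ^ 4)⁻¹)⁻¹ * (2 * (((q : ℝ) + 1) ^ 2 * (ℓF ^ 2 / 4) ^ 2) * (2 * (3 * (ℓF - 1)) * a₀)
        + (((q : ℝ) + 1) * (ℓF ^ 2 / 4) ^ 2 + ((q : ℝ) + 1) ^ 2 * ℓF * (ℓF ^ 2 / 4)) + ((q : ℝ) + 1) * (ℓF ^ 2 / 4) ^ 2)) * ℓF) ^ 2 := by ring
    _ ≤ 6 * (c₀ / cB) * ℓF ^ 3 * 23328 ^ 2 := by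
        gcongr
    _ = (6 * 23328 ^ 2) * ((c₀ / cB) * ℓF ^ 3) := by ring
    _ ≤ 33 * 10 ^ 8 * ((c₀ / cB) * ℓF ^ 3) := mul_le_mul_of_nonneg_right (by norm_num) (by positivity)


end Real

/-! ## §4 ★★★ (K1b-a) at the member: all three rows for the skew ⊗ parabola² interpolant -/

section Member

variable (F : T3Family) (n K : ℕ) (h : n ≤ K) (c₀ cB : ℝ) [Fact (0 < c₀)] [Fact (0 < cB)]

/-- ★★★ **(K1b-a) — ALL THREE ROWS OF THE TRANSPORTED INTERPOLANT OF `Q_k(U₀)` ON `RegPr`**: `RegPr F n K ε₀ U₀`, `10¹⁰L⁶ε₀ ≤ 1`, `10¹²L³ε₀ ≤ 1`, `n < K`, no-wrap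
`2(3(ℓ−1) + 8ℓ + 1) ≤ (F.P K).sitesPerDir 0` ⟹ `∃ E : WL2 →ₗ[ℂ] BondL2K` with (a) `‖Q_k(U₀)(E c) − c‖ ≤ ½‖c‖`, (s1) `‖E c‖ ≤ 45·√(c₀ℓ³∕cB)·‖c‖` (✓`exists_transportedInterpolant_of_regPr`) and
(s2) `Σ_μ‖D^η_{U₀}(toL2S (toL2⁻¹(E c))^μ)‖² ≤ C_D·‖c‖²` with the EXPLICIT `C_D = 2c₀η⁻²·B_c²·d·ℓ^d∕cB` of ★★★`hED_of_formula` at the skew ⊗ parabola² letters (`M_p = ℓ₁²`, `L_p = ℓ₁`, `M_τ = ℓ²∕4`,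
`L_τ = ℓ`, `m = m̂⁻¹`; ✓`Prop7SkewBumpProfile`, ✓`Prop7CovariantBlockBumpsProfile`) — the three letters `hQE`, `hE₁`, `hED` of px12 ✓`Prop7KinvBoundOfInterpolant.norm_KinvT_le_of_interpolant_rows`
(`θ = ½`; `C_D > 0` by inspection). [cite: Balaban1985BackgroundPropagators, (3.13)–(3.16) p.393, (3.126)–(3.132) pp.420–422; Balaban1984PropagatorsI, (1.18) p.20, (1.47)–(1.50) p.26; Balaban1985RegularSpaces, Lemma 1 (1.25) p.79] -/
theorem exists_transportedInterpolant_rows_of_regPr {ε₀ : ℝ} (hε₀ : 0 < ε₀) (hε : 10 ^ 10 * (F.L : ℝ) ^ 6 * ε₀ ≤ 1) (hε12 : 10 ^ 12 * (F.L : ℝ) ^ 3 * ε₀ ≤ 1)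
    (U₀ : GaugeField (F.P K) 0 (Matrix.specialUnitaryGroup (Fin 2) ℂ)) (hreg : RegPr F n K ε₀ U₀) (hnK : n < K)
    (hwrap : 2 * ((F.P K).d * ((F.P K).L ^ (K - n) - 1) + 8 * (F.P K).L ^ (K - n) + 1) ≤ (F.P K).sitesPerDir 0) :
    ∃ E : WL2 ℂ (fun _ : PBond (F.P n) 0 => cB) W₂ →ₗ[ℂ] BondL2K ℂ 3 (periodsT3 F K) c₀ W₂,
      (∀ c : WL2 ℂ (fun _ : PBond (F.P n) 0 => cB) W₂, ‖Qk F n K h c₀ cB U₀ (E c) - c‖ ≤ (1 / 2) * ‖c‖)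
      ∧ (∀ c : WL2 ℂ (fun _ : PBond (F.P n) 0 => cB) W₂, ‖E c‖ ≤ 45 * Real.sqrt (c₀ * ((F.L : ℝ) ^ (K - n)) ^ 3 / cB) * ‖c‖)
      ∧ (∀ c : WL2 ℂ (fun _ : PBond (F.P n) 0 => cB) W₂,
          ∑ μ : Fin (F.P K).d, ‖DL2 F n K c₀ U₀ (toL2S F K c₀ (formComp ((toL2 F K c₀).symm (E c)) μ))‖ ^ 2
            ≤ (2 * c₀ * ((eta F n K)⁻¹ ^ 2 * ((|((∑ s ∈ range ((F.P K).L ^ (K - n)), ((s : ℝ) + 1) * (((s + 1 - ((F.P K).L ^ (K - n) - ((F.P K).L ^ (K - n) / 4 + 1)) : ℕ) : ℝ) * ((((F.P K).L ^ (K - n) : ℕ) : ℝ) - ((s : ℕ) : ℝ)))) * (∑ a ∈ range ((F.P K).L ^ (K - n)), (((a : ℕ) : ℝ) * ((((F.P K).L ^ (K - n) : ℕ) : ℝ) - 1 - ((a : ℕ) : ℝ)))) ^ ((F.P K).d - 1) * ((((F.P K).L : ℝ) ^ ((F.P K).d + 1)) ^ (K - n))⁻¹)⁻¹| * (2 * (((((F.P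 K).L ^ (K - n) / 4 + 1 : ℕ) : ℝ)) ^ 2 * (((((F.P K).L ^ (K - n) : ℕ) : ℝ)) ^ 2 / 4) ^ ((F.P K).d - 1)) * (2 * ((3 : ℝ) * ((F.L : ℝ) ^ (K - n) - 1)) * regThreshold F n K ε₀)
          + (((((F.P K).L ^ (K - n) / 4 + 1 : ℕ) : ℝ)) * (((((F.P K).L ^ (K - n) : ℕ) : ℝ)) ^ 2 / 4) ^ ((F.P K).d - 1) + ((((F.P K).L ^ (K - n) / 4 + 1 : ℕ) : ℝ)) ^ 2 * ((((F.P K).L ^ (K - n) : ℕ) : ℝ)) * (((((F.P K).L ^ (K - n) : ℕ) : ℝ)) ^ 2 / 4) ^ ((F.P K).d - 2)) + ((((F.P K).L ^ (K - n) / 4 + 1 : ℕ) : ℝ)) * (((((F.P K).L ^ (K - n) : ℕ) : ℝ)) ^ 2 / 4) ^ ((F.P K).d - 1))) ^ 2 * (F.P K).d * ((((F.P K).L ^ (F.P K).d) ^ (K - n) : ℕ) : ℝ))) * cB⁻¹)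
              * ‖c‖ ^ 2) := by
  have hℓ3 : 3 ≤ (F.P K).L ^ (K - n) := by
    have hL3 : 3 ≤ F.L := by obtain ⟨a, ha⟩ := F.hL.1; have := F.hL.2; omega
    exact le_trans (by simpa using hL3) (Nat.pow_le_pow_right (F.P K).L_pos (by omega : 1 ≤ K - n))
  obtain ⟨E, hf, hQE, hE1⟩ := Prop7TransportedInterpolantOfRegPr.exists_transportedInterpolant_of_regPr F n K h c₀ cB hε₀ hε hε12 U₀ hreg hnK hwrap
  refine ⟨E, hQE, hE1, ?_⟩
  -- the letters of the skew and parabola profiles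
  have hp0 : (fun s : ℕ => (((s + 1 - ((F.P K).L ^ (K - n) - ((F.P K).L ^ (K - n) / 4 + 1)) : ℕ) : ℝ) * ((((F.P K).L ^ (K - n) : ℕ) : ℝ) - ((s : ℕ) : ℝ)))) 0 = 0 :=
    Prop7SkewBumpProfile.skew_eq_zero_of_lt (by omega)
  have hτ0 : (fun m : ℕ => (((m : ℕ) : ℝ) * ((((F.P K).L ^ (K - n) : ℕ) : ℝ) - 1 - ((m : ℕ) : ℝ)))) 0 = 0 := Prop7CovariantBlockBumpsProfile.tau_zero _
  have hMp : ∀ s, s < (F.P K).L ^ (K - n) → |(fun s : ℕ => (((s + 1 - ((F.P K).L ^ (K - n) - ((F.P K).L ^ (K - n) / 4 + 1)) : ℕ) : ℝ) * ((((F.P K).L ^ (K - n) : ℕ) : ℝ) - ((s : ℕ) : ℝ)))) s| ≤ ((((F.P K).L ^ (K - n) / 4 + 1 : ℕ) : ℝ)) ^ 2 := fun s hs => by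
    simp only []
    rw [abs_of_nonneg (Prop7SkewBumpProfile.skew_nonneg hs)]
    exact Prop7SkewBumpProfile.skew_le hs
  have hLp : ∀ s, s + 1 < (F.P K).L ^ (K - n) → |(fun s : ℕ => (((s + 1 - ((F.P K).L ^ (K - n) - ((F.P K).L ^ (K - n) / 4 + 1)) : ℕ) : ℝ) * ((((F.P K).L ^ (K - n) : ℕ) : ℝ) - ((s : ℕ) : ℝ)))) (s + 1) - (fun s : ℕ => (((s + 1 - ((F.P K).L ^ (K - n) - ((F.P K).L ^ (K - n) / 4 + 1)) : ℕ) : ℝ) * ((((F.P K).L ^ (K - n) : ℕ) : ℝ) - ((s : ℕ) : ℝ)))) s| ≤ ((((F.P K).L ^ (K - n) / 4 + 1 : ℕ) : ℝ)) := fun s hs => by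
    simp only []
    exact Prop7SkewBumpProfile.abs_skew_succ_sub_le hs
  have hℓ1 : 1 ≤ (F.P K).L ^ (K - n) := le_trans (by norm_num) hℓ3
  have hpl : |(fun s : ℕ => (((s + 1 - ((F.P K).L ^ (K - n) - ((F.P K).L ^ (K - n) / 4 + 1)) : ℕ) : ℝ) * ((((F.P K).L ^ (K - n) : ℕ) : ℝ) - ((s : ℕ) : ℝ)))) ((F.P K).L ^ (K - n) - 1)| ≤ ((((F.P K).L ^ (K - n) / 4 + 1 : ℕ) : ℝ)) := by
    simp only []
    rw [Prop7SkewBumpProfile.skew_last hℓ1, abs_of_nonneg (by positivity)]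
  have hτl : (fun m : ℕ => (((m : ℕ) : ℝ) * ((((F.P K).L ^ (K - n) : ℕ) : ℝ) - 1 - ((m : ℕ) : ℝ)))) ((F.P K).L ^ (K - n) - 1) = 0 := Prop7CovariantBlockBumpsProfile.tau_last hℓ1
  have hMτ : ∀ m, m < (F.P K).L ^ (K - n) → |(fun m : ℕ => (((m : ℕ) : ℝ) * ((((F.P K).L ^ (K - n) : ℕ) : ℝ) - 1 - ((m : ℕ) : ℝ)))) m| ≤ (((((F.P K).L ^ (K - n) : ℕ) : ℝ)) ^ 2 / 4) := fun m hm => by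
    simp only []
    rw [abs_of_nonneg (Prop7CovariantBlockBumpsProfile.tau_nonneg hm)]
    exact Prop7CovariantBlockBumpsProfile.tau_le m
  have hLτ : ∀ m, m + 1 < (F.P K).L ^ (K - n) → |(fun m : ℕ => (((m : ℕ) : ℝ) * ((((F.P K).L ^ (K - n) : ℕ) : ℝ) - 1 - ((m : ℕ) : ℝ)))) (m + 1) - (fun m : ℕ => (((m : ℕ) : ℝ) * ((((F.P K).L ^ (K - n) : ℕ) : ℝ) - 1 - ((m : ℕ) : ℝ)))) m| ≤ ((((F.P K).L ^ (K - n) : ℕ) : ℝ)) := fun m hm => by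
    simp only []
    exact Prop7CovariantBlockBumpsProfile.abs_tau_succ_sub_le hm
  exact hED_of_formula F n K h c₀ cB hnK hε₀ U₀ hreg.plaqSmall (fun s : ℕ => (((s + 1 - ((F.P K).L ^ (K - n) - ((F.P K).L ^ (K - n) / 4 + 1)) : ℕ) : ℝ) * ((((F.P K).L ^ (K - n) : ℕ) : ℝ) - ((s : ℕ) : ℝ)))) (fun m : ℕ => (((m : ℕ) : ℝ) * ((((F.P K).L ^ (K - n) : ℕ) : ℝ) - 1 - ((m : ℕ) : ℝ)))) hp0 hτ0 hτl hMp hLp hpl hMτ hLτ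
    (by positivity) (by positivity) (by positivity) (by positivity) (by positivity) ((∑ s ∈ range ((F.P K).L ^ (K - n)), ((s : ℝ) + 1) * (((s + 1 - ((F.P K).L ^ (K - n) - ((F.P K).L ^ (K - n) / 4 + 1)) : ℕ) : ℝ) * ((((F.P K).L ^ (K - n) : ℕ) : ℝ) - ((s : ℕ) : ℝ)))) * (∑ a ∈ range ((F.P K).L ^ (K - n)), (((a : ℕ) : ℝ) * ((((F.P K).L ^ (K - n) : ℕ) : ℝ) - 1 - ((a : ℕ) : ℝ)))) ^ ((F.P K).d - 1) * ((((F.P K).L : ℝ) ^ ((F.P K).d + 1)) ^ (K - n))⁻¹)⁻¹ E hf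

/-- ★★ **THE (s2) CONSTANT IS K-FREE AT THE PIN**: `10¹⁰L⁶ε₀ ≤ 1`, `0 < ε₀`, `n < K` ⟹ `C_D ≤ 33·10⁸·((c₀∕cB)·ℓ³)` — `η⁻¹ = ℓ`, `B_c·ℓ ≤ 23328` (`m̂ ≥ ℓ³ℓ₁³∕5832` from ✓`sum_own_ge`,
✓`mass_ge`; the bracket `2M_ψs + Lip_ψ + ℓ₁M_τ² ≤ 4ℓ²ℓ₁³` from `ℓ ≤ 4ℓ₁`, `a₀ℓ² = ε₀ ≤ ⅓`). [cite: Balaban1985BackgroundPropagators, (3.126)–(3.132) pp.420–422; Balaban1984PropagatorsI, (1.47)–(1.50) p.26] -/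
theorem CD_le_kfree {ε₀ : ℝ} (hε₀ : 0 < ε₀) (hε : 10 ^ 10 * (F.L : ℝ) ^ 6 * ε₀ ≤ 1) (hnK : n < K) :
    (2 * c₀ * ((eta F n K)⁻¹ ^ 2 * ((|((∑ s ∈ range ((F.P K).L ^ (K - n)), ((s : ℝ) + 1) * (((s + 1 - ((F.P K).L ^ (K - n) - ((F.P K).L ^ (K - n) / 4 + 1)) : ℕ) : ℝ) * ((((F.P K).L ^ (K - n) : ℕ) : ℝ) - ((s : ℕ) : ℝ)))) * (∑ a ∈ range ((F.P K).L ^ (K - n)), (((a : ℕ) : ℝ) * ((((F.P K).L ^ (K - n) : ℕ) : ℝ) - 1 - ((a : ℕ) : ℝ)))) ^ ((F.P K).d - 1) * ((((F.P K).L : ℝ) ^ ((F.P K).d + 1)) ^ (K - n))⁻¹)⁻¹| * (2 * (((((F.P K).L ^ (K - n) / 4 + 1 : ℕ) : ℝ)) ^ 2 * (((((F.P K).L ^ (K - n) : ℕ) : ℝ)) ^ 2 / 4) ^ ((F.P K).d - 1)) * (2 * ((3 : ℝ) * ((F.L : ℝ) ^ (K - n) - 1)) * regThreshold F n K ε₀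)
          + (((((F.P K).L ^ (K - n) / 4 + 1 : ℕ) : ℝ)) * (((((F.P K).L ^ (K - n) : ℕ) : ℝ)) ^ 2 / 4) ^ ((F.P K).d - 1) + ((((F.P K).L ^ (K - n) / 4 + 1 : ℕ) : ℝ)) ^ 2 * ((((F.P K).L ^ (K - n) : ℕ) : ℝ)) * (((((F.P K).L ^ (K - n) : ℕ) : ℝ)) ^ 2 / 4) ^ ((F.P K).d - 2)) + ((((F.P K).L ^ (K - n) / 4 + 1 : ℕ) : ℝ)) * (((((F.P K).L ^ (K - n) : ℕ) : ℝ)) ^ 2 / 4) ^ ((F.P K).d - 1))) ^ 2 * (F.P K).d * ((((F.P K).L ^ (F.P K).d) ^ (K - n) : ℕ) : ℝ))) * cB⁻¹)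
      ≤ 33 * 10 ^ 8 * ((c₀ / cB) * ((F.L : ℝ) ^ (K - n)) ^ 3) := by
  classical
  have hcB : (0 : ℝ) < cB := Fact.out
  have hc₀ : (0 : ℝ) < c₀ := Fact.out
  have hd : (F.P K).d = 3 := T3Family.P_d F K
  have hL3 : 3 ≤ F.L := by obtain ⟨a, ha⟩ := F.hL.1; have := F.hL.2; omega
  have hL1r : (1 : ℝ) ≤ F.L := by exact_mod_cast (le_trans (by norm_num) hL3)
  have hk1 : 1 ≤ K - n := by omega
  have hℓ3 : 3 ≤ (F.P K).L ^ (K - n) := le_trans (by simpa using hL3) (Nat.pow_le_pow_right (F.P K).L_pos hk1)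
  have hℓ1 : 1 ≤ (F.P K).L ^ (K - n) := le_trans (by norm_num) hℓ3
  have hℓcast : ((((F.P K).L ^ (K - n) : ℕ)) : ℝ) = (F.L : ℝ) ^ (K - n) := by push_cast; rfl
  have hPL : (((F.P K).L : ℕ) : ℝ) = (F.L : ℝ) := rfl
  -- the one-dimensional letters
  have hOWNge := Prop7SkewBumpProfile.sum_own_ge ((F.P K).L ^ (K - n)) hℓ1
  have hTeq := Prop7CovariantBlockBumpsProfile.sum_tau_eq ((F.P K).L ^ (K - n))
  have hmass := Prop7CovariantBlockBumpsProfile.mass_ge hℓ3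
  have ha₀ := Prop7TransportedInterpolantOfRegPr.regThreshold_mul_sq F n K ε₀
  have ha₀pos := regThreshold_pos F (n := n) (K := K) hε₀
  rw [← hTeq] at hmass
  -- the integers `q = ⌊ℓ∕4⌋`, `ℓ₁ = q + 1`
  set q : ℕ := (F.P K).L ^ (K - n) / 4 with hq
  have hq4 : 4 * q ≤ (F.P K).L ^ (K - n) := by omega
  have hq4' : (F.P K).L ^ (K - n) < 4 * (q + 1) := by omega
  have hlq : (((F.P K).L ^ (K - n) - q : ℕ) : ℝ) = (((F.P K).L ^ (K - n) : ℕ) : ℝ) - q := by rw [Nat.cast_sub (by omega)]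
  rw [hlq] at hOWNge
  -- atoms (before any cast normalisation)
  set OWN : ℝ := ∑ s ∈ range ((F.P K).L ^ (K - n)), ((s : ℝ) + 1) * ((((s + 1 - ((F.P K).L ^ (K - n) - (q + 1))) : ℕ) : ℝ) * ((((F.P K).L ^ (K - n) : ℕ) : ℝ) - ((s : ℕ) : ℝ))) with hOWNd
  set T : ℝ := ∑ a ∈ range ((F.P K).L ^ (K - n)), (((a : ℕ) : ℝ) * ((((F.P K).L ^ (K - n) : ℕ) : ℝ) - 1 - ((a : ℕ) : ℝ))) with hTd
  set a₀ : ℝ := regThreshold F n K ε₀ with ha₀d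
  clear_value OWN T a₀
  -- cast normalisation: `↑(L^k) = (↑L)^k`, `↑(P K).L = ↑L`, `d = 3`
  have hd1 : (F.P K).d - 1 = 2 := by rw [hd]
  have hd2 : (F.P K).d - 2 = 1 := by rw [hd]
  have hd3 : ((F.P K).d : ℝ) = 3 := by rw [hd]; norm_num
  have hη : (eta F n K)⁻¹ = (F.L : ℝ) ^ (K - n) := by
    show (((F.L : ℝ)⁻¹) ^ (K - n))⁻¹ = (F.L : ℝ) ^ (K - n)
    rw [inv_pow, inv_inv]
  rw [hd1, hd2, hd3, hη, hd]
  push_cast at hOWNge hmass ⊢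
  rw [hPL] at hOWNge hmass
  rw [hPL]
  simp only [pow_one]
  have h4 : ((F.L : ℝ) ^ (3 + 1)) ^ (K - n) = ((F.L : ℝ) ^ (K - n)) ^ 4 := by rw [← pow_mul, mul_comm, pow_mul]
  have hvol : ((F.L : ℝ) ^ 3) ^ (K - n) = ((F.L : ℝ) ^ (K - n)) ^ 3 := by rw [← pow_mul, mul_comm, pow_mul]
  rw [h4, hvol]
  have hqr : 4 * (q : ℝ) ≤ (F.L : ℝ) ^ (K - n) := by rw [← hℓcast]; exact_mod_cast hq4
  have hqr' : (F.L : ℝ) ^ (K - n) < 4 * ((q : ℝ) + 1) := by rw [← hℓcast]; exact_mod_cast hq4'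
  have hℓF3 : (3 : ℝ) ≤ (F.L : ℝ) ^ (K - n) := by rw [← hℓcast]; exact_mod_cast hℓ3
  have hq0 : (0 : ℝ) ≤ q := Nat.cast_nonneg _
  have hε3 : ε₀ ≤ 1 / 3 := by
    have hL6 : (1 : ℝ) ≤ (F.L : ℝ) ^ 6 := one_le_pow₀ hL1r
    have h1 : (10 : ℝ) ^ 10 * ε₀ ≤ 10 ^ 10 * (F.L : ℝ) ^ 6 * ε₀ := by
      have := mul_le_mul_of_nonneg_right (mul_le_mul_of_nonneg_left hL6 (by norm_num : (0:ℝ) ≤ 10 ^ 10)) hε₀.le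
      linarith [this]
    linarith
  set ℓF : ℝ := (F.L : ℝ) ^ (K - n) with hℓFd
  have ha₀' : a₀ * ℓF ^ 2 = ε₀ := ha₀
  clear_value ℓF
  clear hOWNd hTd ha₀d hℓFd hℓcast hlq hq hε
  exact kfree_real c₀ cB ℓF OWN T a₀ ε₀ q hc₀ hcB hℓF3 hqr hqr' hOWNge hmass ha₀pos ha₀' hε3

/-- ★★★ **(K1b-a) IN THE K-STOREY'S CURRENCIES** (px10 g13 (K1-fam) letter `hE`): `RegPr F n K ε₀ U₀`, the two windows, `n < K`, no-wrap ⟹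
`∃ E, (‖Q_k(U₀)(E c) − c‖ ≤ ½‖c‖) ∧ (‖E c‖ ≤ 45·√((c₀∕cB)·ℓ³)·‖c‖) ∧ (Σ_μ‖D^η_{U₀}(toL2S (toL2⁻¹(E c))^μ)‖² ≤ 33·10⁸·((c₀∕cB)·ℓ³)·‖c‖²)` — `C₁ L = 45`, `C_D L = 33·10⁸`,
L-ONLY (indeed absolute): K-FREE AT THE PIN `cB = c₀ℓ³`. [cite: Balaban1985BackgroundPropagators, (3.126)–(3.132) pp.420–422; Balaban1984PropagatorsI, (1.47)–(1.50) p.26] -/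
theorem exists_transportedInterpolant_rows_kfree {ε₀ : ℝ} (hε₀ : 0 < ε₀) (hε : 10 ^ 10 * (F.L : ℝ) ^ 6 * ε₀ ≤ 1) (hε12 : 10 ^ 12 * (F.L : ℝ) ^ 3 * ε₀ ≤ 1)
    (U₀ : GaugeField (F.P K) 0 (Matrix.specialUnitaryGroup (Fin 2) ℂ)) (hreg : RegPr F n K ε₀ U₀) (hnK : n < K)
    (hwrap : 2 * ((F.P K).d * ((F.P K).L ^ (K - n) - 1) + 8 * (F.P K).L ^ (K - n) + 1) ≤ (F.P K).sitesPerDir 0) :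
    ∃ E : WL2 ℂ (fun _ : PBond (F.P n) 0 => cB) W₂ →ₗ[ℂ] BondL2K ℂ 3 (periodsT3 F K) c₀ W₂,
      (∀ c : WL2 ℂ (fun _ : PBond (F.P n) 0 => cB) W₂, ‖Qk F n K h c₀ cB U₀ (E c) - c‖ ≤ (1 / 2) * ‖c‖)
      ∧ (∀ c : WL2 ℂ (fun _ : PBond (F.P n) 0 => cB) W₂, ‖E c‖ ≤ 45 * Real.sqrt ((c₀ / cB) * ((F.L : ℝ) ^ (K - n)) ^ 3) * ‖c‖)
      ∧ (∀ c : WL2 ℂ (fun _ : PBond (F.P n) 0 => cB) W₂,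
          ∑ μ : Fin (F.P K).d, ‖DL2 F n K c₀ U₀ (toL2S F K c₀ (formComp ((toL2 F K c₀).symm (E c)) μ))‖ ^ 2
            ≤ 33 * 10 ^ 8 * ((c₀ / cB) * ((F.L : ℝ) ^ (K - n)) ^ 3) * ‖c‖ ^ 2) := by
  obtain ⟨E, hQE, hE1, hED⟩ := exists_transportedInterpolant_rows_of_regPr F n K h c₀ cB hε₀ hε hε12 U₀ hreg hnK hwrap
  have hCD := CD_le_kfree F n K c₀ cB hε₀ hε hnK
  refine ⟨E, hQE, fun c => ?_, fun c => (hED c).trans (mul_le_mul_of_nonneg_right hCD (sq_nonneg _))⟩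
  have h1 := hE1 c
  rwa [show c₀ * ((F.L : ℝ) ^ (K - n)) ^ 3 / cB = c₀ / cB * ((F.L : ℝ) ^ (K - n)) ^ 3 from by ring] at h1

end Member

end Summit.QuantumFields.YangMills.Theorems.Prop7TransportedInterpolantRowsOfRegPr

end
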